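import Summits.Ventures.CertifiedManyBodySolver.Certificates.EmeryCu4O8_kryFam_Hg1201P0_c1hl
import Summits.Ventures.CertifiedManyBodySolver.Downfold.EmeryBoxesKSlicesC
import Summits.Ventures.CertifiedManyBodySolver.Downfold.EmeryBoxesNCCOK26FloorWord
import Summits.Ventures.CertifiedManyBodySolver.Downfold.EmeryBoxesNCCOK26ThermalFloorAtlasWord
import Summits.Ventures.CertifiedManyBodySolver.Downfold.EmeryThermalAtomicFloor
import Summits.Ventures.CertifiedManyBodySolver.Downfold.EmeryThermalCapFromFloorSeam
import HarnessLib

/-!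
# `T > 0` WORDS ON A PRESSURE-CONTINUUM OBJECT (zero kit): cap, ATLAS floor, two-sided window and the HIGH-T-CLOSING window on
# Nd2CuO4 (#56, x = 0 parent column) U-slice — same six-box as NCCOK26 — `emeryBoxNd2CuO4K26` (router/EMERY-FLOOR-ORDERS rows 56·…; first certified thermal statements on a P-hull box)

Venture CertifiedManyBodySolver, cell `pub/hubbard-downfold` (S1 = ROUTER) × crew hubbard-fast S2 (ii) × (iv) «T > 0 × multi-band» (D-0096 (ii)); seat hubbard-downfold-mod-4
(S1/S2 Emery seam, g17). Namespace `Summit.Ventures.CertifiedManyBodySolver.Downfold`. THE OBJECT: the coordinatewise hull of the two computed-pressure U-slices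
(this seat's `EmeryBoxesKSlicesC`; a word on it holds at both computed pressures by the `_refines_PHull` lemmas and at every admitted intermediate P). INPUTS BY NAME (all landed,
nothing recomputed): the four lower-face CuO₄ certificates `nCCOK26Floor_hq 0`, `nCCOK26Floor_hq 1`, `nCCOK26Floor_hq 2`, `nCCOK26Floor_hq 3` (hubbard-box-p2 g17 HULL-ATLAS `EmeryHullAtlasNewVertices*` / g16 vertex floors; tilts μ = (-8, -9, -43/5, -19/2),
q₀ = (-2654597/40000, -6279593/80000, -1467193/20000, -3377403/40000)); hubbard-box-p1's cap law (R153) via this seat's `holdsOn_emeryCellPressureCap_of_tiltedCuO4Certificates`; the `T > 0` FLOOR ATLAS (best of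
hubbard-box-p2's 33 global KLDL-R families at εp = -8: `kryFam_Hg1201P0_c1hl`, C = (-116.055914, -117.202308)); the atomic-limit door `EmeryThermalAtomicFloor` (p681554).
RESULT (every β ≥ 0, hypothesis-free): cap `P_cell ≤ 6 log 2 + 42.2175·β`; window **`29.3006·β ≤ P_cell ≤ 42.2175·β + 6 log 2`** (slope gap 12.9170);
high-T closure `P_cell(0) = 6 log 2`; hubbard-box-p2's T = 0 chord band `emeryBoxNd2CuO4K26_cuprate_energyChordBandAtFilling` is the T = 0 companion.

Everything PROVED (0 sorry); no definition. HONEST FRAMING: CERTIFIED inequalities on an EXTRAPOLATED-grade interpolation object (hull of two SCREENING-grade computed-pressure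
slices); grand-canonical at the stated level; thermal scales NOT resolved; no phase word; no router number moves. WHAT-THIS-IS-NOT: new certificates or kit.
-/

noncomputable section

namespace Summit.Ventures.CertifiedManyBodySolver.Downfold

open NonemptyInterval Matrix Finset Literature.Probability.LatticeModels
open Literature.MathematicalPhysics.QuantumLattice Literature.Computation.Certificates
open Summit.Ventures.CertifiedManyBodySolver.Certificates OccupationCode ClusterLowerBound
open scoped BigOperators ComplexOrder

/-! ## §1 The lower-face corners and their CuO₄ certificates (hubbard-box-p2 g17 HULL-ATLAS `atlasNew_*_hq` / g16 `<vpre>_*_hq`) -/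


/-! ## §2 The `T > 0` cap word at the common level εp = -8 (= max μᵢ; tilts μ = (-8, -9, -43/5, -19/2), levels q₀ = (-2654597/40000, -6279593/80000, -1467193/20000, -3377403/40000), slopes −q₀/2 = (33.1825, 39.2475, 36.6798, 42.2175)) -/

/-- **THE THERMAL CAP WORD (hypothesis-free)** on `emeryBoxNd2CuO4K26`, cuprate signs, level `εp = -8`, EVERY β ≥ 0, EVERY point of the box:
`P_cell ≤ 6 log 2 + β·3377403/80000` (42.2175·β + 4.1589; corner 3 binds) — the four lower-face CuO₄ certificates of hubbard-box-p2's HULL-ATLAS (kit-free for three of four objects' corners; registry code/atlas/state/plan.json) through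
hubbard-box-p1's R153 and monotone level transfer. [cite: Israel1979, Thm. I.2.4] [cite: ValentiStolzeHirschfeld1991, §II] -/
theorem emeryBoxNd2CuO4K26_pressureCap_m8 {β : ℝ} (hβ : 0 ≤ β) :
    HoldsOn (fun p : EmeryCoord → ℝ => emeryCellPressure β (emeryLine cuprateSigns (emeryLineCoords (((-8 : ℚ)) : ℝ) p)) ≤ 6 * Real.log 2 + β * (3377403/80000 : ℝ)) emeryBoxNd2CuO4K26 :=
  holdsOn_emeryCellPressureCap_of_tiltedCuO4Certificates (E := emeryBoxNd2CuO4K26) (eA := nccoK26Emery_tpd) (eB := nccoK26Emery_tpp) (eD := nccoK26Emery_Delta) (eUd := nccoK26Emery_Udd) (eUp := nccoK26Emery_Upp) emeryBoxNd2CuO4K26_entries.1 emeryBoxNd2CuO4K26_entries.2.1 emeryBoxNd2CuO4K26_entries.2.2.1 emeryBoxNd2CuO4K26_entries.2.2.2.1 emeryBoxNd2CuO4K26_entries.2.2.2.2 cuprateSigns hβ (M := 2) two_pos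
    (fun _ => 0) (fun _ ω' _ => re_expect_zero_cuO4 ω') (![-8, -9, -43/5, -19/2] : Fin 4 → ℝ) (![-2654597/40000, -6279593/80000, -1467193/20000, -3377403/40000] : Fin 4 → ℝ)
    (fun i => by
      rw [nCCOK26_lowerCorner]
      fin_cases i
      · simpa [nCCOK26Corner, nCCOK26Floor_mu, nCCOK26Floor_q0] using nCCOK26Floor_hq 0
      · simpa [nCCOK26Corner, nCCOK26Floor_mu, nCCOK26Floor_q0] using nCCOK26Floor_hq 1
      · simpa [nCCOK26Corner, nCCOK26Floor_mu, nCCOK26Floor_q0] using nCCOK26Floor_hq 2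
      · simpa [nCCOK26Corner, nCCOK26Floor_mu, nCCOK26Floor_q0] using nCCOK26Floor_hq 3)
    (fun i => by fin_cases i <;> simp <;> norm_num) (fun i => by fin_cases i <;> simp <;> norm_num)

/-- **Grand-potential reading**: at chemical potential 8 eV, every `T > 0`, every point: `Ω/CuO₂ = −P_cell/β ≥ −3377403/80000 − 6 log 2/β` eV. [cite: Israel1979, Thm. I.2.4] -/
theorem emeryBoxNd2CuO4K26_grandPotential_ge_m8 {β : ℝ} (hβ : 0 < β) :
    HoldsOn (fun p : EmeryCoord → ℝ => -(3377403/80000 : ℝ) - 6 * Real.log 2 / β ≤ -emeryCellPressure β (emeryLine cuprateSigns (emeryLineCoords (((-8 : ℚ)) : ℝ) p)) / β) emeryBoxNd2CuO4K26 :=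
  holdsOn_grandPotential_ge_of_pressureCap cuprateSigns hβ _ (emeryBoxNd2CuO4K26_pressureCap_m8 hβ.le)

/-! ## §3 The ATLAS family floor (best of 33 global KLDL-R families at εp = -8: `kryFam_Hg1201P0_c1hl`, N = 19, 20) and the two-sided window — the closed-form member bounds are the reference object’s landed lemmas `nCCOK26Atlas_Hg1201P0_c1hl_m8_cap<j>` (EmeryBoxesNCCOK26ThermalFloorAtlasWord), imported, not restated -/

/-- **`T > 0` ATLAS FAMILY FLOOR** on the whole box, every β ≥ 0: `¼·log Σⱼ e^{−βCⱼ} ≤ P_cell`, C = (-58027957/500000, -29300577/250000). [cite: Ruelle1969, §2.5–2.6] [cite: Israel1979, Lemma II.3.1] -/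
theorem emeryBoxNd2CuO4K26_pressureFloorFam_m8 {β : ℝ} (hβ : 0 ≤ β) :
    HoldsOn (fun p : EmeryCoord → ℝ => Real.log (Real.exp (-(β * (-58027957/500000 : ℝ))) + Real.exp (-(β * (-29300577/250000 : ℝ)))) / 4 ≤ emeryCellPressure β (emeryLine cuprateSigns (emeryLineCoords (((-8 : ℚ)) : ℝ) p))) emeryBoxNd2CuO4K26 := by
  have h := holdsOn_emeryCellPressureFloor_of_rayleighTraces (E := emeryBoxNd2CuO4K26) (εp := -8) (eA := nccoK26Emery_tpd) (eB := nccoK26Emery_tpp) (eD := nccoK26Emery_Delta)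
    (eUd := nccoK26Emery_Udd) (eUp := nccoK26Emery_Upp) emeryBoxNd2CuO4K26_entries.1 emeryBoxNd2CuO4K26_entries.2.1 emeryBoxNd2CuO4K26_entries.2.2.1 emeryBoxNd2CuO4K26_entries.2.2.2.1 emeryBoxNd2CuO4K26_entries.2.2.2.2 cuprateSigns hβ
    (φ := fun i => ((kryFam_Hg1201P0_c1hl i).unit : Fock (Orb (Fin 1 ×ₗ Fin 12)))) kryFam_Hg1201P0_c1hl_orthonormal
    (T := fun i a => ((kryFam_Hg1201P0_c1hl_S i a : ℤ) : ℝ) / ((kryFam_Hg1201P0_c1hl_NN i : ℤ) : ℝ)) kryFam_Hg1201P0_c1hl_traces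
  intro p hp
  have h' := h p hp
  simp only [Fin.sum_univ_two] at h'
  refine le_trans ?_ h'
  exact div_le_div_of_nonneg_right (Real.log_le_log (by positivity) (add_le_add (Real.exp_le_exp.2 (neg_le_neg (mul_le_mul_of_nonneg_left nCCOK26Atlas_Hg1201P0_c1hl_m8_cap0 hβ))) (Real.exp_le_exp.2 (neg_le_neg (mul_le_mul_of_nonneg_left nCCOK26Atlas_Hg1201P0_c1hl_m8_cap1 hβ))))) (by norm_num)

/-- **Linear reading of the floor**: `β·29300577/1000000 ≤ P_cell` (29.3006·β). [cite: Ruelle1969, §2.5–2.6] -/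
theorem emeryBoxNd2CuO4K26_pressureFloorLinear_m8 {β : ℝ} (hβ : 0 ≤ β) :
    HoldsOn (fun p : EmeryCoord → ℝ => β * (29300577/1000000 : ℝ) ≤ emeryCellPressure β (emeryLine cuprateSigns (emeryLineCoords (((-8 : ℚ)) : ℝ) p))) emeryBoxNd2CuO4K26 := by
  intro p hp
  refine le_trans ?_ (emeryBoxNd2CuO4K26_pressureFloorFam_m8 hβ p hp)
  have hk : β * (29300577/1000000 : ℝ) = Real.log (Real.exp (-(β * (-29300577/250000 : ℝ)))) / 4 := by
    rw [Real.log_exp]; ring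
  rw [hk]
  refine div_le_div_of_nonneg_right (Real.log_le_log (by positivity) ?_) (by norm_num)
  nlinarith [Real.exp_pos (-(β * (-58027957/500000 : ℝ)))]

/-- **TWO-SIDED `T > 0` WINDOW ON THE PRESSURE-HULL BOX** (hypothesis-free on both sides), level εp = -8, EVERY β ≥ 0:
`¼·log Σⱼ e^{−βCⱼ} ≤ P_cell ≤ 6 log 2 + β·3377403/80000` (linear reading `29.3006·β ≤ P_cell ≤ 42.2175·β + 4.1589`; slope gap 12.9170). It holds at BOTH computed pressures and at every
admitted intermediate P (the box's premise). [cite: Israel1979, Thm. I.2.4] [cite: Ruelle1969, §2.5–2.6] -/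
theorem emeryBoxNd2CuO4K26_pressureWindow_m8 {β : ℝ} (hβ : 0 ≤ β) :
    HoldsOn (fun p : EmeryCoord → ℝ => Real.log (Real.exp (-(β * (-58027957/500000 : ℝ))) + Real.exp (-(β * (-29300577/250000 : ℝ)))) / 4 ≤ emeryCellPressure β (emeryLine cuprateSigns (emeryLineCoords (((-8 : ℚ)) : ℝ) p)) ∧ emeryCellPressure β (emeryLine cuprateSigns (emeryLineCoords (((-8 : ℚ)) : ℝ) p)) ≤ 6 * Real.log 2 + β * (3377403/80000 : ℝ)) emeryBoxNd2CuO4K26 :=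
  fun p hp => ⟨emeryBoxNd2CuO4K26_pressureFloorFam_m8 hβ p hp, emeryBoxNd2CuO4K26_pressureCap_m8 hβ p hp⟩

/-- **Linear reading of the window**: `β·29300577/1000000 ≤ P_cell ≤ 6 log 2 + β·3377403/80000`. [cite: Israel1979, Thm. I.2.4] -/
theorem emeryBoxNd2CuO4K26_pressureWindow_m8_linear {β : ℝ} (hβ : 0 ≤ β) :
    HoldsOn (fun p : EmeryCoord → ℝ => β * (29300577/1000000 : ℝ) ≤ emeryCellPressure β (emeryLine cuprateSigns (emeryLineCoords (((-8 : ℚ)) : ℝ) p)) ∧ emeryCellPressure β (emeryLine cuprateSigns (emeryLineCoords (((-8 : ℚ)) : ℝ) p)) ≤ 6 * Real.log 2 + β * (3377403/80000 : ℝ)) emeryBoxNd2CuO4K26 :=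
  fun p hp => ⟨emeryBoxNd2CuO4K26_pressureFloorLinear_m8 hβ p hp, emeryBoxNd2CuO4K26_pressureCap_m8 hβ p hp⟩

/-! ## §4 The atomic-limit floor and the HIGH-TEMPERATURE-CLOSING window -/

/-- **ATOMIC-LIMIT `T > 0` FLOOR** on the whole box at εp = -8, every β ≥ 0 (door `holdsOn_emeryCellPressureAtomicFloor`; Cu at μ_d = 11/2, U_d,hi = 5287/1000; O at μ_p = 8,
U_p,hi = 2249/500); value `6 log 2` at β = 0, classical slope 28.7170·β as β → ∞. [cite: Ruelle1969, §2.5–2.6] [cite: Ueltschi1999, §3] -/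
theorem emeryBoxNd2CuO4K26_pressureAtomicFloor_m8 {β : ℝ} (hβ : 0 ≤ β) :
    HoldsOn (fun p : EmeryCoord → ℝ => Real.log (atomicPartitionFnReal β (5287/1000 : ℝ) (11/2 : ℝ)) + 2 * Real.log (atomicPartitionFnReal β (2249/500 : ℝ) (8 : ℝ)) ≤ emeryCellPressure β (emeryLine cuprateSigns (emeryLineCoords (((-8 : ℚ)) : ℝ) p))) emeryBoxNd2CuO4K26 := by
  intro p hp
  have h := holdsOn_emeryCellPressureAtomicFloor (E := emeryBoxNd2CuO4K26) (eA := nccoK26Emery_tpd) (eB := nccoK26Emery_tpp) (eD := nccoK26Emery_Delta) (eUd := nccoK26Emery_Udd) (eUp := nccoK26Emery_Upp) (-8) emeryBoxNd2CuO4K26_entries.1 emeryBoxNd2CuO4K26_entries.2.1 emeryBoxNd2CuO4K26_entries.2.2.1 emeryBoxNd2CuO4K26_entries.2.2.2.1 emeryBoxNd2CuO4K26_entries.2.2.2.2 cuprateSigns hβ p hp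
  simp only [nccoK26Emery_Delta, nccoK26Emery_Udd, nccoK26Emery_Upp, Entry.encl_ofEnds_snd] at h
  push_cast at h
  norm_num at h ⊢
  exact h

/-- **THE HIGH-TEMPERATURE-CLOSING TWO-SIDED `T > 0` WINDOW** on the whole box, εp = -8, every β ≥ 0: `max(atomic, family) ≤ P_cell ≤ 6 log 2 + β·3377403/80000`; both sides
equal `6 log 2` at β = 0; crossover β* ≈ 1.502 (T* ≈ 7725 K) [float]. Table [float]:
| β (1/eV) | T (K) | atomic floor | family floor | best floor | cap | width |
|---|---|---|---|---|---|---|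
| 0.01 | 1160450 | 4.3402 | 0.4649 | 4.3402 | 4.5811 | 0.2408 |
| 0.1 | 116045 | 6.1363 | 3.0894 | 6.1363 | 8.3806 | 2.2443 |
| 0.5 | 23209 | 16.0085 | 14.7621 | 16.0085 | 25.2677 | 9.2592 |
| 1 | 11604 | 29.7971 | 29.3696 | 29.7971 | 46.3764 | 16.5793 |
| 2 | 5802 | 58.2732 | 58.6252 | 58.6252 | 88.5940 | 29.9688 |
| 5 | 2321 | 144.1094 | 146.5037 | 146.5037 | 215.2466 | 68.7429 |
| 10 | 1160 | 287.3832 | 293.0058 | 293.0058 | 426.3343 | 133.3285 |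
| 20 | 580 | 574.3679 | 586.0115 | 586.0115 | 848.5096 | 262.4981 |
| 40 | 290 | 1148.6804 | 1172.0231 | 1172.0231 | 1692.8604 | 520.8373 |
[cite: Israel1979, Thm. I.2.4] [cite: Ruelle1969, §2.5–2.6] [cite: Ueltschi1999, §3] -/
theorem emeryBoxNd2CuO4K26_pressureWindowHighT_m8 {β : ℝ} (hβ : 0 ≤ β) :
    HoldsOn (fun p : EmeryCoord → ℝ =>
      max (Real.log (atomicPartitionFnReal β (5287/1000 : ℝ) (11/2 : ℝ)) + 2 * Real.log (atomicPartitionFnReal β (2249/500 : ℝ) (8 : ℝ))) (Real.log (Real.exp (-(β * (-58027957/500000 : ℝ))) + Real.exp (-(β * (-29300577/250000 : ℝ)))) / 4) ≤ emeryCellPressure β (emeryLine cuprateSigns (emeryLineCoords (((-8 : ℚ)) : ℝ) p)) ∧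
      emeryCellPressure β (emeryLine cuprateSigns (emeryLineCoords (((-8 : ℚ)) : ℝ) p)) ≤ 6 * Real.log 2 + β * (3377403/80000 : ℝ)) emeryBoxNd2CuO4K26 :=
  fun p hp => ⟨max_le (emeryBoxNd2CuO4K26_pressureAtomicFloor_m8 hβ p hp) (emeryBoxNd2CuO4K26_pressureFloorFam_m8 hβ p hp), emeryBoxNd2CuO4K26_pressureCap_m8 hβ p hp⟩

/-- **At β = 0 the window is a point**: `P_cell(0, ·) = 6 log 2` on the whole box. [cite: Ueltschi1999, §3] -/
theorem emeryBoxNd2CuO4K26_pressure_beta_zero_m8 :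
    HoldsOn (fun p : EmeryCoord → ℝ => emeryCellPressure 0 (emeryLine cuprateSigns (emeryLineCoords (((-8 : ℚ)) : ℝ) p)) = 6 * Real.log 2) emeryBoxNd2CuO4K26 := by
  intro p hp
  have h := emeryBoxNd2CuO4K26_pressureWindowHighT_m8 le_rfl p hp
  rw [atomicPartitionFnReal_beta_zero, atomicPartitionFnReal_beta_zero, show (4 : ℝ) = 2 ^ 2 by norm_num, Real.log_pow] at h
  simp only [Nat.cast_ofNat, zero_mul, add_zero] at h
  have h1 := (le_max_left _ _).trans h.1
  linarith [h.2]

end Summit.Ventures.CertifiedManyBodySolver.Downfold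

end
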